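import Mathlib
import Summits.NavierStokesRegularity.FluidComputer.TransportGalerkinAbcEigen
import HarnessLib

/-!
# KEEP for the forced-ABC model from a certified real eigenvalue: the eigen inputs of `half_prediction_abc` discharged by the X0 door (instab g18, cell `ns-blowup`, 2026-08-27)

HONEST FRAMING (human ruling D-0035): nothing here is a claim about Navier–Stokes blow-up.
WHAT THIS IS NOT: not NS evidence — MODEL lane (the perturbation equation of forced ABC on `T³`,
`H²`-scaled Fourier phase space); no certificate, number or census word moves. ONE sentence:
**`exists_keep_eigenvector_abc`** — if `μ ≥ 0` is a (certified) REAL eigenvalue of the linearisation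
about `abcFlow A B C` with viscosity `ν ≥ 0` (`Torus.IsLinNSEigenvalue ν (abcFlow A B C) μ`, the OUTPUT
of the cell's X0 chains `AbcClassIIX0` / `AbcClassIIEigenpair`), then there is a unit, rapidly
decreasing, real, divergence-free, Leray-fixed `v ∈ E` (so `ε • v ∈ W` for all small `ε` under a
polynomial radii floor, `TransportGalerkinAbcEigen.exists_seed_mem_box_abc`) such that the KEEP
conclusion `ε e^{μt}/2 ≤ ‖w t‖` of `TransportGalerkinAbc.half_prediction_abc` holds for every choice of
the REMAINING inputs: radii, RESIDENCE (β3) from a seed set `Z ∋ ε • v`, the certificate objects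
`G₁, G₂, G` with h₁/h₂/hL/htail/μ-bounds and the gap `ω < 2μ`, the margin `C′` and the smallness
window, and a classical solution `w` of the full system in `W` from `ε • v`. The two eigen hypotheses
of `half_prediction_abc` (`‖v‖ = 1`, `hres`) and the exact-eigenvector property are supplied by
`TransportGalerkinAbcEigen.exists_eigenData_of_isLinNSEigenvalue_abc`; nothing else changes.
Mathlib + the tree files cited; no new definitions.
-/

noncomputable section

namespace Summit.NavierStokesRegularity.FluidComputer.TransportGalerkinAbcKeep

open Set Filter Topology Finset RCLike MeasureTheory UnitAddTorus
open Literature.Analysis.FunctionSpaces Literature.Analysis.FunctionSpaces.Lattice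
open Literature.Analysis.FunctionSpaces.Torus Literature.Analysis.FunctionSpaces.EuclideanSpace
open Literature.Analysis.ODE
open Literature.Analysis.FluidPDE
open Summit.NavierStokesRegularity.FluidComputer.TransportGalerkin
open Summit.NavierStokesRegularity.FluidComputer.TransportGalerkinAbc
open Summit.NavierStokesRegularity.FluidComputer.TransportGalerkinAbcEigen
open scoped ENNReal NNReal ComplexConjugate InnerProductSpace

/-- **KEEP for the forced-ABC model from a certified real eigenvalue.** See the module docstring:
the eigenvector `v` is produced from `Torus.IsLinNSEigenvalue ν (abcFlow A B C) μ`; every other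
hypothesis is that of `TransportGalerkinAbc.half_prediction_abc` verbatim (with `λ = μ`). -/
theorem exists_keep_eigenvector_abc (A B C : ℝ) {ν μ : ℝ} (hν : 0 ≤ ν) (hμ : 0 ≤ μ)
    (heig : Torus.IsLinNSEigenvalue ν (Torus.abcFlow A B C) (μ : ℂ)) :
    ∃ v : lp (fun _ : (Fin 3 → ℤ) => EuclideanSpace ℂ (Fin 3)) 2,
      ‖v‖ = 1 ∧ RapidDecay (⇑v) ∧ (∀ k, lerayCLM k (v k) = v k) ∧
      (∀ (j : Fin 3) (k : Fin 3 → ℤ), (EuclideanSpace.proj j : EuclideanSpace ℂ (Fin 3) →L[ℂ] ℂ) (v (-k)) =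
        conj ((EuclideanSpace.proj j : EuclideanSpace ℂ (Fin 3) →L[ℂ] ℂ) (v k))) ∧
      (∀ k : Fin 3 → ℤ, ∑ j, ((k j : ℤ) : ℂ) * (EuclideanSpace.proj j : EuclideanSpace ℂ (Fin 3) →L[ℂ] ℂ) (v k) = 0) ∧
      linOp ν (mFourierCoeff (complexify ∘ Torus.abcFlow A B C))
          (fun j => (EuclideanSpace.proj j : EuclideanSpace ℂ (Fin 3) →L[ℂ] ℂ)) lerayCLM v = μ • v ∧
      ∀ {ρ : (Fin 3 → ℤ) → ℝ} (hρ0 : ∀ k, 0 ≤ ρ k) (hρ1 : Summable fun k => sobolevWeight 1 k * ρ k)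
        (hρ2 : Summable fun k => (sobolevWeight 2 k * ρ k) ^ 2)
        {Z : Set (lp (fun _ : (Fin 3 → ℤ) => EuclideanSpace ℂ (Fin 3)) 2)} {T : ℝ}
        {u : ℕ → lp (fun _ : (Fin 3 → ℤ) => EuclideanSpace ℂ (Fin 3)) 2 → ℝ →
          lp (fun _ : (Fin 3 → ℤ) => EuclideanSpace ℂ (Fin 3)) 2}
        (hT : 0 ≤ T) (hZ : Z ⊆ box ρ (fun j => (EuclideanSpace.proj j : EuclideanSpace ℂ (Fin 3) →L[ℂ] ℂ)) lerayCLM)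
        (sol_continuousOn : ∀ n, ∀ x ∈ Z, ContinuousOn (u n x) (Icc 0 T))
        (sol_init : ∀ n, ∀ x ∈ Z, u n x 0 = cubeProj n x)
        (sol_hasDerivAt : ∀ n, ∀ x ∈ Z, ∀ t ∈ Ioo 0 T,
          HasDerivAt (u n x) (cubeProj n (nsField ν (mFourierCoeff (EuclideanSpace.complexify ∘ Torus.abcFlow A B C))
            (fun j => (EuclideanSpace.proj j : EuclideanSpace ℂ (Fin 3) →L[ℂ] ℂ)) lerayCLM (u n x t))) t)
        (sol_mem : ∀ n, ∀ x ∈ Z, ∀ t ∈ Icc 0 T, u n x t ∈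
          box ρ (fun j => (EuclideanSpace.proj j : EuclideanSpace ℂ (Fin 3) →L[ℂ] ℂ)) lerayCLM)
        (sol_proj : ∀ n, ∀ x ∈ Z, ∀ t ∈ Icc 0 T, cubeProj n (u n x t) = u n x t)
        {μt : ℝ}
        {G₁ G₂ G : lp (fun _ : (Fin 3 → ℤ) => EuclideanSpace ℂ (Fin 3)) 2 →L[ℝ]
          lp (fun _ : (Fin 3 → ℤ) => EuclideanSpace ℂ (Fin 3)) 2}
        (hG₁ : ∀ x y : lp (fun _ : (Fin 3 → ℤ) => EuclideanSpace ℂ (Fin 3)) 2, ⟪G₁ x, y⟫_ℂ = ⟪x, G₁ y⟫_ℂ)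
        (hG₂ : ∀ x y : lp (fun _ : (Fin 3 → ℤ) => EuclideanSpace ℂ (Fin 3)) 2, ⟪G₂ x, y⟫_ℂ = ⟪x, G₂ y⟫_ℂ)
        (hG : ∀ x y : lp (fun _ : (Fin 3 → ℤ) => EuclideanSpace ℂ (Fin 3)) 2, ⟪G x, y⟫_ℂ = ⟪x, G y⟫_ℂ)
        (hG₁P : ∀ n, ∀ w z : lp (fun _ : (Fin 3 → ℤ) => EuclideanSpace ℂ (Fin 3)) 2,
          ⟪G₁ w, cubeProj n z⟫_ℂ = ⟪G₁ (cubeProj n w), z⟫_ℂ)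
        (hG₂P : ∀ n, ∀ w z : lp (fun _ : (Fin 3 → ℤ) => EuclideanSpace ℂ (Fin 3)) 2,
          ⟪G₂ w, cubeProj n z⟫_ℂ = ⟪G₂ (cubeProj n w), z⟫_ℂ)
        (hGP : ∀ n, ∀ w z : lp (fun _ : (Fin 3 → ℤ) => EuclideanSpace ℂ (Fin 3)) 2,
          ⟪G w, cubeProj n z⟫_ℂ = ⟪G (cubeProj n w), z⟫_ℂ)
        (hG₁pos : ∀ x : lp (fun _ : (Fin 3 → ℤ) => EuclideanSpace ℂ (Fin 3)) 2, 0 ≤ re ⟪G₁ x, x⟫_ℂ)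
        {ω c m₂ M₁ : ℝ} (hc : 0 < c) (hm₂ : 0 < m₂) (hM₁ : 0 ≤ M₁)
        (hm₂' : ∀ x : lp (fun _ : (Fin 3 → ℤ) => EuclideanSpace ℂ (Fin 3)) 2, m₂ * ‖x‖ ^ 2 ≤ re ⟪G₂ x, x⟫_ℂ)
        (hM₁' : ∀ x : lp (fun _ : (Fin 3 → ℤ) => EuclideanSpace ℂ (Fin 3)) 2,
          re ⟪G₁ x, x⟫_ℂ ≤ M₁ * (eNormSq (-1) (⇑x)).toReal)
        {m M ω₁ : ℝ} (hm0 : 0 < m)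
        (hm : ∀ x : lp (fun _ : (Fin 3 → ℤ) => EuclideanSpace ℂ (Fin 3)) 2, m * ‖x‖ ^ 2 ≤ re ⟪G x, x⟫_ℂ)
        (hM : ∀ x : lp (fun _ : (Fin 3 → ℤ) => EuclideanSpace ℂ (Fin 3)) 2, re ⟪G x, x⟫_ℂ ≤ M * ‖x‖ ^ 2)
        (h₁ : ∀ n, ∀ w : lp (fun _ : (Fin 3 → ℤ) => EuclideanSpace ℂ (Fin 3)) 2,
          2 * re ⟪G₁ (cubeProj n w), linOp ν (mFourierCoeff (EuclideanSpace.complexify ∘ Torus.abcFlow A B C))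
            (fun j => (EuclideanSpace.proj j : EuclideanSpace ℂ (Fin 3) →L[ℂ] ℂ)) lerayCLM (cubeProj n w)⟫_ℂ +
            c * re ⟪G₂ (cubeProj n w), cubeProj n w⟫_ℂ ≤ 2 * ω * re ⟪G₁ (cubeProj n w), cubeProj n w⟫_ℂ)
        (h₂ : ∀ n, ∀ w : lp (fun _ : (Fin 3 → ℤ) => EuclideanSpace ℂ (Fin 3)) 2,
          re ⟪G₂ (cubeProj n w), linOp ν (mFourierCoeff (EuclideanSpace.complexify ∘ Torus.abcFlow A B C))
            (fun j => (EuclideanSpace.proj j : EuclideanSpace ℂ (Fin 3) →L[ℂ] ℂ)) lerayCLM (cubeProj n w)⟫_ℂ ≤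
            ω * re ⟪G₂ (cubeProj n w), cubeProj n w⟫_ℂ)
        (hL : ∀ n, ∀ w : lp (fun _ : (Fin 3 → ℤ) => EuclideanSpace ℂ (Fin 3)) 2,
          re ⟪G (cubeProj n w), linOp ν (mFourierCoeff (EuclideanSpace.complexify ∘ Torus.abcFlow A B C))
            (fun j => (EuclideanSpace.proj j : EuclideanSpace ℂ (Fin 3) →L[ℂ] ℂ)) lerayCLM (cubeProj n w)⟫_ℂ ≤
            ω₁ * re ⟪G (cubeProj n w), cubeProj n w⟫_ℂ)
        (hμ₁ : μt ≤ ω₁) (hμ₂ : μt ≤ ω)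
        (htail : ∀ n, ∀ q : lp (fun _ : (Fin 3 → ℤ) => EuclideanSpace ℂ (Fin 3)) 2, cubeProj n q = 0 →
          2 * μt * re ⟪G₁ q, q⟫_ℂ + c * re ⟪G₂ q, q⟫_ℂ ≤ 2 * ω * re ⟪G₁ q, q⟫_ℂ)
        {ε : ℝ} (hgap : ω < 2 * μ) (hε : 0 < ε) (hx : ε • v ∈ Z)
        {C' : ℝ}
        (hCC' : Real.sqrt (M₁ / (c * m₂)) * (2 * ((Fintype.card (Fin 3) : ℝ) * (2 * Real.pi)) *
            Real.sqrt ((∑' l : Fin 3 → ℤ, ENNReal.ofReal (sobolevWeight (-2) l ^ 2)).toReal)) *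
            Real.sqrt (Real.pi / (2 * μ - ω)) < C')
        (hsmall : ∀ t ∈ Icc 0 T, C' * (3 / 2 : ℝ) ^ 2 * (ε * Real.exp (μ * t)) < 3 / 2 - 1)
        {w : ℝ → lp (fun _ : (Fin 3 → ℤ) => EuclideanSpace ℂ (Fin 3)) 2} (hw : ContinuousOn w (Icc 0 T))
        (hw0 : w 0 = ε • v)
        (hw' : ∀ t ∈ Ioo 0 T, HasDerivAt w (nsField ν (mFourierCoeff (EuclideanSpace.complexify ∘ Torus.abcFlow A B C))
          (fun j => (EuclideanSpace.proj j : EuclideanSpace ℂ (Fin 3) →L[ℂ] ℂ)) lerayCLM (w t)) t)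
        (hwW : ∀ t ∈ Icc 0 T, w t ∈ box ρ (fun j => (EuclideanSpace.proj j : EuclideanSpace ℂ (Fin 3) →L[ℂ] ℂ)) lerayCLM)
        {t : ℝ} (ht : t ∈ Icc 0 T) (hχ : ε * Real.exp (μ * t) ≤ 2 / (9 * C')),
        ε * Real.exp (μ * t) / 2 ≤ ‖w t‖ := by
  obtain ⟨v, hv1, hvr, hvP, hvreal, hvdiv, hAv, hres⟩ := exists_eigenData_of_isLinNSEigenvalue_abc A B C heig
  refine ⟨v, hv1, hvr, hvP, hvreal, hvdiv, hAv, ?_⟩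
  intro ρ hρ0 hρ1 hρ2 Z T u hT hZ sol_continuousOn sol_init sol_hasDerivAt sol_mem sol_proj μt G₁ G₂ G hG₁ hG₂ hG
    hG₁P hG₂P hGP hG₁pos ω c m₂ M₁ hc hm₂ hM₁ hm₂' hM₁' m M ω₁ hm0 hm hM h₁ h₂ hL hμ₁ hμ₂ htail ε hgap hε hx C'
    hCC' hsmall w hw hw0 hw' hwW t ht hχ
  exact half_prediction_abc A B C hν hρ0 hρ1 hρ2 hT hZ sol_continuousOn sol_init sol_hasDerivAt sol_mem sol_proj
    hG₁ hG₂ hG hG₁P hG₂P hGP hG₁pos hc hm₂ hM₁ hm₂' hM₁' hm0 hm hM h₁ h₂ hL hμ₁ hμ₂ htail hv1 hgap hμ hε hx hres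
    hCC' hsmall hw hw0 hw' hwW ht hχ

end Summit.NavierStokesRegularity.FluidComputer.TransportGalerkinAbcKeep

end
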